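import Summits.FinalStateConjecture.FinalStateConjecture.Theorems.PhotonSphereChannelsExteriorEnergyRW
import Literature.Geometry.Lorentzian.ReggeWheelerHorizonMass

/-!
# Crux `WindowedShellChannels` (stmt-FinalStateConjecture-14085), line `Sketch` — glue toolkit, part 2
# (two crude bounds for the unit-mass Regge–Wheeler potentials along the centred tortoise line)

For `s ≤ ℓ` and `V = V_{s,ℓ}(r(x))`, `r = tortoiseRadius one_pos 0` (photon sphere at `x = 0`):

* `linePotential_le_factor` : `V(x) ≤ (1 − 2/r(x))·(ℓ+1)²/r(x)²` (since `2/r < 1 ≤ ℓ + 1`);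
* `linePotential_le_exp`    : `V(x) ≤ (ℓ+1)²·e^{x/2}` everywhere (from `r − 2 ≤ e^{1/2}e^{x/2}`,
  `IsTortoiseRadius.sub_two_mul_le`, and `r > 2`) — the input of `stub_lateDropExp` on the reflected
  horizon side;
* `linePotential_le_inv_sq` : `V(x) ≤ 9(ℓ+1)²/x²` for `x ≥ 1` (from `x = r + 2 log(r−2) − 3 ≤ 3r − 9`) — the
  input of `stub_lateDropInvSq` on the far side.

No definitions. [folklore]
-/

noncomputable section

set_option linter.dupNamespace false

open Set Real

namespace Summit.FinalStateConjecture.FinalStateConjecture.Theorems.WindowedShellChannelsSketch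

open Literature.Geometry.Lorentzian Literature.Geometry.Lorentzian.ReggeWheeler

namespace Glue

/-- `V_{s,ℓ}(ρ) ≤ (1 − 2/ρ)(ℓ+1)²/ρ²` for the unit-mass potentials at area radius `ρ > 2` (`s ≤ ℓ`).
[folklore] -/
theorem rwPotential_le_factor {s ℓ : ℕ} (hsℓ : s ≤ ℓ) {ρ : ℝ} (h2 : 2 < ρ) :
    rwPotential 1 s ℓ ρ ≤ (1 - 2 / ρ) * (((ℓ : ℝ) + 1) ^ 2 / ρ ^ 2) := by
  have hρ0 : 0 < ρ := by linarith
  have hf : 0 < 1 - 2 / ρ := by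
    rw [sub_pos, div_lt_one hρ0]; exact h2
  have hℓ : (s : ℝ) ≤ ℓ := by exact_mod_cast hsℓ
  have hs0 : (0 : ℝ) ≤ s := by positivity
  unfold rwPotential
  rw [show (2 : ℝ) * 1 = 2 by norm_num]
  refine mul_le_mul_of_nonneg_left ?_ hf.le
  -- `ℓ(ℓ+1)/ρ² + (1 − s²)·2/ρ³ ≤ (ℓ+1)²/ρ²`
  rw [div_add_div _ _ (by positivity) (by positivity), div_le_div_iff₀ (by positivity) (by positivity)]
  have key : (ℓ : ℝ) * ((ℓ : ℝ) + 1) * ρ ^ 3 + (1 - (s : ℝ) ^ 2) * 2 * ρ ^ 2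
      ≤ ((ℓ : ℝ) + 1) ^ 2 * ρ ^ 3 := by
    have hℓ0 : (0 : ℝ) ≤ ℓ := by positivity
    have hρ2 : 0 < ρ ^ 2 := by positivity
    have : (1 - (s : ℝ) ^ 2) * 2 * ρ ^ 2 ≤ 2 * ρ ^ 2 := by nlinarith
    have : 2 * ρ ^ 2 ≤ ρ ^ 3 := by nlinarith
    nlinarith
  have hρ2 : 0 ≤ ρ ^ 2 := by positivity
  calc ((ℓ : ℝ) * ((ℓ : ℝ) + 1) * ρ ^ 3 + ρ ^ 2 * ((1 - (s : ℝ) ^ 2) * 2)) * ρ ^ 2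
      = ((ℓ : ℝ) * ((ℓ : ℝ) + 1) * ρ ^ 3 + (1 - (s : ℝ) ^ 2) * 2 * ρ ^ 2) * ρ ^ 2 := by ring
    _ ≤ (((ℓ : ℝ) + 1) ^ 2 * ρ ^ 3) * ρ ^ 2 := mul_le_mul_of_nonneg_right key hρ2
    _ = ((ℓ : ℝ) + 1) ^ 2 * (ρ ^ 2 * ρ ^ 3) := by ring

/-- `V_{s,ℓ} ≤ (1 − 2/r)(ℓ+1)²/r²` along the unit-mass centred tortoise line (`s ≤ ℓ`). [folklore] -/
theorem linePotential_le_factor {s ℓ : ℕ} (hsℓ : s ≤ ℓ) (x : ℝ) :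
    linePotential 1 s ℓ (tortoiseRadius one_pos 0) x
      ≤ (1 - 2 / tortoiseRadius one_pos 0 x) * (((ℓ : ℝ) + 1) ^ 2 / tortoiseRadius one_pos 0 x ^ 2) := by
  have hr := isTortoiseRadius_tortoiseRadius one_pos (0 : ℝ)
  have h2 : 2 < tortoiseRadius one_pos 0 x := by have := hr.two_mul_lt x; linarith
  rw [linePotential_apply]
  exact rwPotential_le_factor hsℓ h2

/-- **Horizon-side bound**: `V_{s,ℓ}(x) ≤ (ℓ+1)² e^{x/2}` for every `x` (unit mass, centred line, `s ≤ ℓ`).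
[folklore] -/
theorem linePotential_le_exp {s ℓ : ℕ} (hsℓ : s ≤ ℓ) (x : ℝ) :
    linePotential 1 s ℓ (tortoiseRadius one_pos 0) x ≤ ((ℓ : ℝ) + 1) ^ 2 * Real.exp (x / 2) := by
  have hr := isTortoiseRadius_tortoiseRadius one_pos (0 : ℝ)
  set ρ : ℝ := tortoiseRadius one_pos 0 x with hρ
  have h2 : 2 < ρ := by have := hr.two_mul_lt x; linarith
  have hρ0 : 0 < ρ := by linarith
  have hsub : ρ - 2 ≤ Real.exp (1 / 2) * Real.exp (x / 2) := by
    have h := hr.sub_two_mul_le x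
    simp only [mul_one, sub_zero, one_mul] at h
    exact h
  have he : Real.exp (1 / 2) ≤ 2 := by
    have h1 : Real.exp (1 / 2) ^ 2 = Real.exp 1 := by
      rw [← Real.exp_nat_mul]; norm_num
    have h3 : Real.exp 1 < 3 := by
      have := Real.exp_one_lt_d9; linarith
    nlinarith [Real.exp_pos (1 / 2)]
  have hE : 0 < Real.exp (x / 2) := Real.exp_pos _
  -- `1 − 2/ρ = (ρ − 2)/ρ ≤ (ρ − 2)/2 ≤ e^{x/2}` and `1/ρ² ≤ 1/4`
  have hfac : 1 - 2 / ρ ≤ Real.exp (x / 2) := by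
    rw [show 1 - 2 / ρ = (ρ - 2) / ρ by field_simp]
    rw [div_le_iff₀ hρ0]
    nlinarith
  have hinv : ((ℓ : ℝ) + 1) ^ 2 / ρ ^ 2 ≤ ((ℓ : ℝ) + 1) ^ 2 := by
    rw [div_le_iff₀ (by positivity)]
    have : (1 : ℝ) ≤ ρ ^ 2 := by nlinarith
    nlinarith [sq_nonneg ((ℓ : ℝ) + 1)]
  have hf0 : 0 ≤ 1 - 2 / ρ := by
    rw [sub_nonneg, div_le_one hρ0]; exact h2.le
  calc linePotential 1 s ℓ (tortoiseRadius one_pos 0) x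
      ≤ (1 - 2 / ρ) * (((ℓ : ℝ) + 1) ^ 2 / ρ ^ 2) := linePotential_le_factor hsℓ x
    _ ≤ Real.exp (x / 2) * ((ℓ : ℝ) + 1) ^ 2 :=
        mul_le_mul hfac hinv (by positivity) hE.le
    _ = ((ℓ : ℝ) + 1) ^ 2 * Real.exp (x / 2) := by ring

/-- Along the centred unit-mass tortoise line, `r(x) ≥ (x + 9)/3` (from `log u ≤ u − 1`). [folklore] -/
theorem radius_ge (x : ℝ) : (x + 9) / 3 ≤ tortoiseRadius one_pos 0 x := by
  have hr := isTortoiseRadius_tortoiseRadius one_pos (0 : ℝ)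
  set ρ : ℝ := tortoiseRadius one_pos 0 x with hρ
  have h2 : 2 < ρ := by have := hr.two_mul_lt x; linarith
  have htc := hr.tortoiseCoord_eq x
  rw [sub_zero] at htc
  unfold tortoiseCoord at htc
  rw [Real.log_one] at htc
  have hlog : Real.log (ρ - 2 * 1) ≤ ρ - 2 * 1 - 1 := Real.log_le_sub_one_of_pos (by linarith)
  have : x ≤ 3 * ρ - 9 := by nlinarith
  linarith

/-- **Far-side bound**: `V_{s,ℓ}(x) ≤ 9(ℓ+1)²/x²` for `x ≥ 1` (unit mass, centred line, `s ≤ ℓ`).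
[folklore] -/
theorem linePotential_le_inv_sq {s ℓ : ℕ} (hsℓ : s ≤ ℓ) {x : ℝ} (hx : 1 ≤ x) :
    linePotential 1 s ℓ (tortoiseRadius one_pos 0) x ≤ 9 * ((ℓ : ℝ) + 1) ^ 2 / x ^ 2 := by
  have hr := isTortoiseRadius_tortoiseRadius one_pos (0 : ℝ)
  set ρ : ℝ := tortoiseRadius one_pos 0 x with hρ
  have h2 : 2 < ρ := by have := hr.two_mul_lt x; linarith
  have hρ0 : 0 < ρ := by linarith
  have hρx : (x + 9) / 3 ≤ ρ := radius_ge x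
  have hx0 : 0 < x := by linarith
  have hf1 : 1 - 2 / ρ ≤ 1 := by
    have : 0 < 2 / ρ := by positivity
    linarith
  have hf0 : 0 ≤ 1 - 2 / ρ := by
    rw [sub_nonneg, div_le_one hρ0]; exact h2.le
  have hinv : ((ℓ : ℝ) + 1) ^ 2 / ρ ^ 2 ≤ 9 * ((ℓ : ℝ) + 1) ^ 2 / x ^ 2 := by
    rw [div_le_div_iff₀ (by positivity) (by positivity)]
    have hx3 : x ≤ 3 * ρ := by linarith
    have : x ^ 2 ≤ 9 * ρ ^ 2 := by nlinarith
    nlinarith [sq_nonneg ((ℓ : ℝ) + 1)]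
  calc linePotential 1 s ℓ (tortoiseRadius one_pos 0) x
      ≤ (1 - 2 / ρ) * (((ℓ : ℝ) + 1) ^ 2 / ρ ^ 2) := linePotential_le_factor hsℓ x
    _ ≤ 1 * (9 * ((ℓ : ℝ) + 1) ^ 2 / x ^ 2) := mul_le_mul hf1 hinv (by positivity) zero_le_one
    _ = 9 * ((ℓ : ℝ) + 1) ^ 2 / x ^ 2 := one_mul _

end Glue

/-- **Registered principal statement of this file** (`gluePotential_bounds`): the two crude bounds
`V ≤ (ℓ+1)²e^{x/2}` (all `x`) and `V ≤ 9(ℓ+1)²/x²` (`x ≥ 1`) for the unit-mass centred Regge–Wheeler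
potentials, `s ≤ ℓ`. [folklore] -/
theorem gluePotential_bounds : ∀ (s ℓ : ℕ), s ≤ ℓ →
    (∀ x : ℝ, linePotential 1 s ℓ (tortoiseRadius one_pos 0) x ≤ ((ℓ : ℝ) + 1) ^ 2 * Real.exp (x / 2)) ∧
    ∀ x : ℝ, 1 ≤ x → linePotential 1 s ℓ (tortoiseRadius one_pos 0) x ≤ 9 * ((ℓ : ℝ) + 1) ^ 2 / x ^ 2 :=
  fun _ _ hsℓ => ⟨fun x => Glue.linePotential_le_exp hsℓ x, fun _ hx => Glue.linePotential_le_inv_sq hsℓ hx⟩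

end Summit.FinalStateConjecture.FinalStateConjecture.Theorems.WindowedShellChannelsSketch

end
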